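import Summits.AtomisticToContinuum.Crystallization.Theorems.NashClassCertificatesNashHullBridge

/-!
# LINE `one_resolution` — a NEXT-RUNG line on crux `NashNearField` (stmt-AtomisticToContinuum-16827)

LINE HEADER (G1 forward-rung generator `fwd-rung-AtomisticToContinuum-02`; NOT registered as the crux's
skeleton — the live lead's skeleton v10.2 on 16827 is untouched):

* route      : `route-AtomisticToContinuum-NashClassCertificates`
* crux       : `NashClassCertificates.NashNearField` (16827) — this line does NOT conclude the crux; it
               records the smallest strengthening of the PROVED bridge `NashHullBridge` (16828) that the
               bridge's proof does not reach, and where that proof stops.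
* floor F    : `LayeredWindowsLocal.nashHullBridge_proof : NashHullBridge`
               (`NashTwoShellGap → NashNearField → layered windows along ground states`).
* family     : `Rung (H : Set ℝ)` := `NashTwoShellGap → (∀ η ∈ H, NashNearFieldAt η) → LW_gs`, graded by the
               set `H` of resolutions at which the Nash near field is assumed (`rung_mono`: `H ⊆ H' → Rung H →
               Rung H'`).  `Rung (Set.Ioi 0)` is the floor on the nose (`rung_floor`); `Rung ∅` is
               "`NashTwoShellGap` alone gives layered windows".
* rung_decl  : `OneResolutionBridge := Rung {1/50}` — the near field at ONE resolution `η₀ = 1/50` suffices.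
* rung_of    : `oneResolutionBridge_imp_floor : OneResolutionBridge → Rung (Set.Ioi 0)` (and the floor is
               `NashHullBridge` verbatim, `rung_floor_iff`).
* on path    : `rung_of_layeredWindows : HullMinimality.LayeredWindows → Rung H` (the route's thesis X gives
               every rung).
* failure pt : `LayeredWindowsLocal.cleanCentres_of` uses `hNF η hη` at EVERY `η > 0` because the gluing lemma
               `PrestressSplitKorn.stub_layeredGluing` needs the local tolerance `η(R, ε) → 0`
               (`HullBridgeExact.wg_eventually_window`); with the near field at the single resolution `1/50`
               one gets clean centres at tolerance `1/50` only (`stub_cleanCentresAt`), and the step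
               "coarse clean ball ⇒ fine window" (`CoarseToFine`) is exactly what is missing.
* idea       : COARSE-TO-FINE BY RIGIDITY OF CLEAN HULL ELEMENTS — local limits of ground states centred at
               `1/50`-clean centres are infinite, `1/3`-separated, everywhere two-shell-good and everywhere
               `1/50`-layered-near configurations inheriting minimality; `CleanHullRigidity (1/50)` says such a
               hull element IS an exact box-layered set (a PERTURBATIVE Barlow–Liouville theorem: compare the
               non-perturbative `DisclinationRation.BarlowLiouville` 15801 from `1/20`-goodness, the hcp
               `ExcessDecayLiouville.HcpLiouville` 9332, and the stability input
               `DisclinationRation.UniformPolytypeStability` 15800); compactness returns it as `CoarseToFine`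
               (`stub_limitGlue`, pattern of the PROVED `ExcessDecayLiouville.grainsGlue_proof`).
* stubs      : `stub_cleanCentresAt` (routine re-run of `cleanCentres_of` at `η = 1/50`),
               `stub_limitGlue : CleanHullRigidity (1/50) → CoarseToFine (1/50)` (compactness, M),
               `stub_cleanHullRigidity : CleanHullRigidity (1/50)` (the new theorem, L–XL).
* composition: `OneResolutionBridge_of` (kernel-checked, no sorry): stubs ⇒ rung, by the spacing-compactness
               end of `HullBridgeExact.stub_windowsOfGluing` (`hb_exists_global_spacing`).
-/

noncomputable section

open scoped BigOperators Classical
open Filter Topology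

namespace Summit.AtomisticToContinuum.Crystallization.Cruxes.NashNearField.OneResolution

open Summit.AtomisticToContinuum.Crystallization.Theses
open Summit.AtomisticToContinuum.Crystallization.Theorems
open Summit.AtomisticToContinuum.Crystallization.Theorems.PrestressSplitKorn
open Summit.AtomisticToContinuum.Crystallization.Theorems.DefectFreeCrystallizes.Negative.PredicateAPI (Good)
open Summit.AtomisticToContinuum.Crystallization.Theorems.ChargedEnergyGapNegative (E3)
open Literature.MathematicalPhysics.StatisticalMechanics Literature.Geometry.DiscreteGeometry

/-! ### The window format of `HullMinimality.LayeredWindows` / `NashHullBridge` -/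

/-- `x : Fin N → E3` carries an `(R, ε)`-WINDOW of in-layer spacing `a`: after a translation `t`, on the ball of
radius `R` it is two-way `ε`-matched with a rigid image of a box-layered set (triangular layers of spacing
`a`, hole registry `haggLabel s`, any Hägg word `s`, interlayer increments in `[39a/50, 17a/20]`).  Body
verbatim the window clause of `NashHullBridge` / `hb_window_mono`. -/
def HasWindow {N : ℕ} (x : Fin N → E3) (a R ε : ℝ) : Prop :=
  ∃ (A : E3 →ₗᵢ[ℝ] E3) (t : E3) (s : ℤ → ℤ) (z : ℤ → ℝ), IsHaggSeq s ∧
    (∀ m : ℤ, 39 / 50 * a ≤ z (m + 1) - z m ∧ z (m + 1) - z m ≤ 17 / 20 * a) ∧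
    let S : Set E3 := {p | ∃ m i j : ℤ, p = A (((i : ℝ) • triangularVec₁ a) +
      ((j : ℝ) • triangularVec₂ a) + ((haggLabel s m : ℝ) • barlowOffset a) +
      (z m • layerNormal 1))}
    (∀ p ∈ S, ‖p‖ ≤ R → ∃ i : Fin N, dist (x i + t) p ≤ ε) ∧
    (∀ i : Fin N, ‖x i + t‖ ≤ R → ∃ p ∈ S, dist (x i + t) p ≤ ε)

/-- Layered windows at every scale with ONE spacing, along the sequence `x` (the conclusion of
`NashHullBridge` for `x`, i.e. `HullMinimality.LayeredWindows` specialised to `x`). -/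
def LWConclusion (x : (N : ℕ) → (Fin N → E3)) : Prop :=
  ∃ a : ℝ, 47 / 50 ≤ a ∧ a ≤ 1 ∧ ∀ R ε : ℝ, 0 < ε → ∃ᶠ N in Filter.atTop, HasWindow (x N) a R ε

/-! ### The graded family -/

/-- The Nash near field AT ONE RESOLUTION `η`: the body of `NashClassCertificates.NashNearField` with its leading
`∀ η : ℝ, 0 < η →` removed (verbatim otherwise), so that `NashNearField` is definitionally
`∀ η, 0 < η → NashNearFieldAt η`. -/
def NashNearFieldAt (η : ℝ) : Prop :=
  ∃ c : ℝ, 0 < c ∧ ∃ C : ℝ, ∀ (N : ℕ) (x : Fin N → EuclideanSpace ℝ (Fin 3)), (∀ i j : Fin N, i ≠ j → 1 / 3 ≤ dist (x i) (x j)) → (∀ (i : Fin N) (y : EuclideanSpace ℝ (Fin 3)), (∀ j : Fin N, j ≠ i → y ≠ x j) → Literature.MathematicalPhysics.StatisticalMechanics.siteEnergy Literature.MathematicalPhysics.StatisticalMechanics.lennardJones x i ≤ ∑ j ∈ Finset.univ.erase i, Literature.MathematicalPhysics.StatisticalMechanics.lennardJones (dist y (x j))) → ∀ Ω : Finset (Fin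 N), (∀ i ∈ Ω, Literature.Geometry.DiscreteGeometry.IsTwoShellGood (1 / 20) (47 / 50) 1 x i) → c * (Nat.card {i : Fin N // i ∈ Ω ∧ ¬ (∃ (A : EuclideanSpace ℝ (Fin 3) →ₗᵢ[ℝ] EuclideanSpace ℝ (Fin 3)) (t : EuclideanSpace ℝ (Fin 3)) (a : ℝ) (s : ℤ → ℤ) (z : ℤ → ℝ), 47 / 50 ≤ a ∧ a ≤ 1 ∧ Literature.MathematicalPhysics.StatisticalMechanics.IsHaggSeq s ∧ (∀ m : ℤ, 39 / 50 * a ≤ z (m + 1) - z m ∧ z (m + 1) - z m ≤ 17 / 20 * a) ∧ let S : Set (EuclideanSpace ℝ (Fin 3)) := {p | ∃ m i j : ℤ, p = A (((i : ℝ) • Literature.MathematicalPhysics.StatisticalMechanics.triangularVec₁ a) + ((j : ℝ) • Literature.MathematicalPhysics.StatisticalMechanics.triangularVec₂ a) + ((Literature.MathematicalPhysics.StatisticalMechanics.haggLabel s m : ℝ) • Literature.MathematicalPhysics.StatisticalMechanics.barlowOffset a) + (z m • Literature.MathematicalPhysics.StatisticalMechanics.layerNormal 1))}; (∀ j : Fin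 N, dist (x j) (x i) ≤ 2 → ∃ p ∈ S, dist (x j + t) p ≤ η) ∧ (∀ p ∈ S, dist p (x i + t) ≤ 2 → ∃ j : Fin N, dist (x j + t) p ≤ η))} : ℝ) - C * (Nat.card {i : Fin N // i ∈ Ω ∧ ∃ j : Fin N, j ∉ Ω ∧ dist (x j) (x i) ≤ 4} : ℝ) ≤ ∑ i ∈ Ω, ((1 / 2 : ℝ) * (∑ j ∈ Finset.univ.erase i, Literature.MathematicalPhysics.StatisticalMechanics.lennardJones (dist (x i) (x j))) - (⨅ Q : Literature.MathematicalPhysics.StatisticalMechanics.PeriodicConfiguration 3, Q.energyPerParticle Literature.MathematicalPhysics.StatisticalMechanics.lennardJones))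

/-- `NashNearField` is, definitionally, the near field at every positive resolution. -/
theorem nashNearField_iff :
    NashClassCertificates.NashNearField ↔ ∀ η : ℝ, 0 < η → NashNearFieldAt η :=
  Iff.rfl

/-- **The graded family.** `Rung H`: the Nash-class two-shell gap and the Nash near field at the resolutions
`η ∈ H` give layered windows at every scale along every sequence of Lennard-Jones ground states.  Smaller `H`
= weaker hypothesis = STRONGER rung (`rung_mono`); `Rung (Set.Ioi 0)` is the floor `NashHullBridge`;
`Rung ∅` says that `NashTwoShellGap` ALONE gives the windows. -/
def Rung (H : Set ℝ) : Prop :=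
  NashClassCertificates.NashTwoShellGap → (∀ η ∈ H, NashNearFieldAt η) →
    ∀ x : (N : ℕ) → (Fin N → E3), (∀ N, IsGroundState lennardJones (x N)) → LWConclusion x

/-- **THE RUNG** (crux #1 of the line): the Nash near field at the SINGLE resolution `η₀ = 1/50` suffices — no
`∀ η > 0`, no rate `c(η)`, no flatness at ever finer scales. -/
def OneResolutionBridge : Prop :=
  Rung {(1 / 50 : ℝ)}

/-- The family is graded: fewer resolutions assumed, stronger rung. -/
theorem rung_mono {H H' : Set ℝ} (h : H ⊆ H') : Rung H → Rung H' :=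
  fun hR hG hNF => hR hG fun η hη => hNF η (h hη)

/-- **SPECIAL CASE = THE FLOOR** (F3): `Rung (Set.Ioi 0)` is the proved bridge `nashHullBridge_proof`
(definitional unfolding only). -/
theorem rung_floor : Rung (Set.Ioi 0) :=
  fun hG hNF x hx => LayeredWindowsLocal.nashHullBridge_proof hG (fun η hη => hNF η hη) x hx

/-- The floor member of the family is `NashHullBridge` verbatim. -/
theorem rung_floor_iff : Rung (Set.Ioi 0) ↔ NashClassCertificates.NashHullBridge :=
  ⟨fun h hG hNF x hx => h hG (fun η hη => hNF η hη) x hx,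
   fun h hG hNF x hx => h hG (fun η hη => hNF η hη) x hx⟩

/-- **rung ⇒ floor** (`{1/50} ⊆ Set.Ioi 0`). -/
theorem oneResolutionBridge_imp_floor : OneResolutionBridge → Rung (Set.Ioi 0) :=
  rung_mono (Set.singleton_subset_iff.2 (by norm_num))

/-- **On path**: the route's thesis `HullMinimality.LayeredWindows` gives every member of the family (so
`S → thesis → rung`; the rung is a rung, not the summit). -/
theorem rung_of_layeredWindows (H : Set ℝ) (hLW : HullMinimality.LayeredWindows) : Rung H :=
  fun _ _ x hx => hLW x hx

/-! ### The two statements of the line beyond the floor -/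

/-- CLEAN CENTRES AT ONE TOLERANCE (what the floor's localisation still gives from `NashNearFieldAt η₀`):
along a ground-state sequence, for every radius `R'`, eventually some particle has every particle within `R'`
of it two-shell good AND `η₀`-layered-near. -/
def CleanCentresAt (η₀ : ℝ) : Prop :=
  NashClassCertificates.NashTwoShellGap → NashNearFieldAt η₀ →
    ∀ x : (N : ℕ) → (Fin N → E3), (∀ N, IsGroundState lennardJones (x N)) →
      ∀ R' : ℝ, ∀ᶠ N : ℕ in atTop, ∃ i : Fin N, ∀ j : Fin N,
        dist (x N j) (x N i) ≤ R' → Good (x N) j ∧ LayeredNear η₀ (x N) j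

/-- COARSE-TO-FINE ALONG GROUND STATES (the failure point of the floor's proof, as a statement): for every scale
`(R, ε)` there are `R''` and `N₀` such that every Lennard-Jones ground state with `N ≥ N₀` particles that is
two-shell good and `η₀`-layered-near at every particle of an `R''`-ball carries an `(R, ε)`-window of some
spacing `a ∈ [47/50, 1]`.  No near field, no Nash class: minimality of the ground state is the hypothesis that
must do the work (strained clean clusters show it is load-bearing). -/
def CoarseToFine (η₀ : ℝ) : Prop :=
  ∀ R ε : ℝ, 0 < ε → ∃ R'' : ℝ, ∃ N₀ : ℕ, ∀ N : ℕ, N₀ ≤ N → ∀ x : Fin N → E3,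
    IsGroundState lennardJones x → ∀ i : Fin N,
      (∀ j : Fin N, dist (x j) (x i) ≤ R'' → Good x j ∧ LayeredNear η₀ x j) →
      ∃ a ∈ Set.Icc (47 / 50 : ℝ) 1, HasWindow x a R ε

/-- Set-level `η`-layered-nearness of the `2`-ball of `p` in an infinite configuration `X` (the analogue of
`PrestressSplitKorn.LayeredNear` for hull elements). -/
def LayeredNearSet (η : ℝ) (X : Set E3) (p : E3) : Prop :=
  ∃ (A : E3 →ₗᵢ[ℝ] E3) (t : E3) (a : ℝ) (s : ℤ → ℤ) (z : ℤ → ℝ), InBox a z ∧ IsHaggSeq s ∧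
    let S : Set E3 := Set.range fun l : ℤ × ℤ × ℤ => A (layeredPos a s z l)
    (∀ q ∈ X, dist q p ≤ 2 → ∃ r ∈ S, dist (q + t) r ≤ η) ∧
      (∀ r ∈ S, dist r (p + t) ≤ 2 → ∃ q ∈ X, dist (q + t) r ≤ η)

/-- `X` is a HULL ELEMENT (local limit) of the sequence `x`: along a subsequence `φ` and translations `τ`, two-way
`ε`-matching on every ball `B(0, R)` eventually (verbatim the `HL` clause of `DisclinationRation.BarlowLiouville`
/ `GscTwinLoopSurgery.LocalLimitStable`). -/
def IsHullElement (x : (N : ℕ) → (Fin N → E3)) (X : Set E3) : Prop :=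
  ∃ φ : ℕ → ℕ, StrictMono φ ∧ ∃ τ : ℕ → E3, ∀ R ε : ℝ, 0 < ε → ∀ᶠ j : ℕ in Filter.atTop,
    (∀ p ∈ X, ‖p‖ ≤ R → ∃ i : Fin (φ j), dist (x (φ j) i + τ j) p ≤ ε) ∧
    (∀ i : Fin (φ j), ‖x (φ j) i + τ j‖ ≤ R → ∃ p ∈ X, dist (x (φ j) i + τ j) p ≤ ε)

/-- **PERTURBATIVE BARLOW–LIOUVILLE FOR CLEAN HULL ELEMENTS** (the new theorem of the line, tolerance `η₀`): a
hull element of a sequence of Lennard-Jones ground states that contains `0`, is `1/3`-separated, and is at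
EVERY point two-shell good and `η₀`-layered-near, IS — exactly — a translate of a rigid image of a box-layered
set `layeredPos a s z` (`InBox a z`, `IsHaggSeq s`).  Minimality enters only through "hull element of ground
states" (canonical GSC: `GscTwinLoopSurgery.localLimitStable_proof`; bulk-optimal:
`HullExactificationCascade.hullBulkOptimal_proof`), which is what kills the zero-energy-density drift modes
(uniform strain, log-spiral rotation drift) that mere force balance allows. -/
def CleanHullRigidity (η₀ : ℝ) : Prop :=
  ∀ x : (N : ℕ) → (Fin N → E3), (∀ N, IsGroundState lennardJones (x N)) →
    ∀ X : Set E3, IsHullElement x X → (0 : E3) ∈ X →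
      (∀ p ∈ X, ∀ q ∈ X, p ≠ q → (1 / 3 : ℝ) ≤ dist p q) →
      (∀ p ∈ X, IsTwoShellGoodSet (1 / 20) (47 / 50) 1 X p ∧ LayeredNearSet η₀ X p) →
      ∃ (A : E3 →ₗᵢ[ℝ] E3) (t : E3) (a : ℝ) (s : ℤ → ℤ) (z : ℤ → ℝ), InBox a z ∧ IsHaggSeq s ∧
        ∀ p : E3, p ∈ X ↔ ∃ l : ℤ × ℤ × ℤ, p + t = A (layeredPos a s z l)

/-! ### Registered stubs (sorries live ONLY here) -/

/-- STUB 1 (routine, S/M): clean centres at the single tolerance `1/50` — the proof of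
`LayeredWindowsLocal.cleanCentres_of` verbatim with `hNF` used at `η = 1/50` only, fed by
`goodWindows_of_nashTwoShellGap`. -/
theorem stub_cleanCentresAt : CleanCentresAt (1 / 50) := by
  sorry

/-- STUB 2 (compactness glue, M): rigidity of clean hull elements returns as coarse-to-fine along ground states —
by contradiction, centre the offending `1/50`-clean `R''_k`-balls (`R''_k → ∞`) at `0`, extract a local limit
(`1/3`-separation: `Literature…LocalMatchingCompactness` / the pattern of `grainsGlue_proof`), check it is a hull
element everywhere good and `1/50`-layered-near (closed conditions), apply rigidity, and transfer the exact
layered structure back as an `(R, ε)`-window for large `k`. -/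
theorem stub_limitGlue : CleanHullRigidity (1 / 50) → CoarseToFine (1 / 50) := by
  sorry

/-- STUB 3 (the theorem, L–XL): perturbative Barlow–Liouville for clean hull elements at tolerance `1/50`.
Inputs foreseen: uniform polytype stability (`DisclinationRation.UniformPolytypeStability` 15800), excess-decay
iteration in the small-tolerance regime (pattern of `ExcessDecayLiouville.excessDecay_proof`), bulk optimality of
hull elements (`hullBulkOptimal_proof`) against affine / drift modes. -/
theorem stub_cleanHullRigidity : CleanHullRigidity (1 / 50) := by
  sorry

/-! ### Composition (kernel-checked): the three stubs give the rung -/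

/-- **Composition.** Clean centres at tolerance `1/50`, coarse-to-fine along ground states (from rigidity via the
limit glue), and compactness in the spacing (`hb_exists_global_spacing` with `hb_window_mono`, `hb_window_neg`,
`hb_window_rescale`, exactly as in `HullBridgeExact.stub_windowsOfGluing`) give `OneResolutionBridge`. -/
theorem OneResolutionBridge_of (h₁ : CleanCentresAt (1 / 50))
    (h₂ : CleanHullRigidity (1 / 50) → CoarseToFine (1 / 50)) (h₃ : CleanHullRigidity (1 / 50)) :
    OneResolutionBridge := by
  intro hG hNF x hx
  have hcentre := h₁ hG (hNF (1 / 50) rfl) x hx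
  have hctf : CoarseToFine (1 / 50) := h₂ h₃
  let W : ℕ → ℝ → ℝ → Set ℝ := fun N R ε => {a | a ∈ Set.Icc (47 / 50 : ℝ) 1 ∧ HasWindow (x N) a R ε}
  have hbox : ∀ N R ε, W N R ε ⊆ Set.Icc (47 / 50 : ℝ) 1 := fun N R ε a ha => ha.1
  have hmono : ∀ N R R₂ ε ε₂, R₂ ≤ R → ε ≤ ε₂ → W N R ε ⊆ W N R₂ ε₂ :=
    fun N R R₂ ε ε₂ hR hε a ha => ⟨ha.1, hb_window_mono (x N) hR hε ha.2⟩
  have hneg : ∀ N R ε a, R < 0 → a ∈ Set.Icc (47 / 50 : ℝ) 1 → a ∈ W N R ε :=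
    fun N R ε a hR ha => ⟨ha, hb_window_neg (x N) hR (by linarith [ha.1])⟩
  have hresc : ∀ N R ε a a', 0 ≤ R → 0 < ε → a' ∈ W N (2 * R + 1) (ε / 2) →
      a ∈ Set.Icc (47 / 50 : ℝ) 1 → |a - a'| ≤ ε / (8 * (R + 1)) → a ∈ W N R ε :=
    fun N R ε a a' hR hε ha' ha haa =>
      ⟨ha, hb_window_rescale (x N) hR hε ha.1 ha.2 ha'.1.1 ha'.1.2 haa ha'.2⟩
  have hne : ∀ R ε, 0 < ε → ∀ᶠ N in atTop, (W N R ε).Nonempty := by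
    intro R ε hε
    obtain ⟨R'', N₀, hwin⟩ := hctf R ε hε
    filter_upwards [hcentre R'', eventually_ge_atTop N₀] with N hN hN₀
    obtain ⟨i, hi⟩ := hN
    obtain ⟨a, ha, hW⟩ := hwin N hN₀ (x N) (hx N) i hi
    exact ⟨a, ha, hW⟩
  obtain ⟨a, ha, hwin⟩ := hb_exists_global_spacing W hbox hmono hneg hresc hne
  exact ⟨a, ha.1, ha.2, fun R ε hε => (hwin R ε hε).mono fun N hN => hN.2⟩

/-- **The rung from the registered stubs** (what `#h21_check_skeleton` audits). -/
theorem OneResolutionBridge_holds_of_stubs : OneResolutionBridge :=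
  OneResolutionBridge_of stub_cleanCentresAt stub_limitGlue stub_cleanHullRigidity

end Summit.AtomisticToContinuum.Crystallization.Cruxes.NashNearField.OneResolution

end
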